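import Mathlib
import Summits.PneNP.PneNP.Theses.OverlapGapAlgebra
import Summits.PneNP.PneNP.Theorems.OverlapGapAlgebraSearchHardWindowMacroNoStableSection
import Summits.PneNP.PneNP.Theorems.OverlapGapAlgebraCruxesImplyTarget
import Summits.PneNP.PneNP.Theorems.OverlapGapAlgebraPositiveSatProbability

/-!
# PneNP / OverlapGapAlgebra — `SearchHardWindow` (stmt-PneNP-2460) from a MACRO-STEP transfer: the
# weakest transfer the route now needs

Support for crux stmt-PneNP-2460 (`Summit.PneNP.PneNP.Theses.OverlapGapAlgebra.SearchHardWindow`).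
`searchHardWindow_of_windowTransfer'` (`…FromTransfer.lean`) derives the crux from the WINDOW form of
the transfer crux `SolvableImpliesStableSection` (stmt-PneNP-2463): a polynomial-time solver with
non-vanishing success would have to yield, infinitely often, a section that is `ν`-valid at ALL
`k·mk+1` splice points of the Bresler–Huang path and `ηn`-stable at EVERY single-literal step, with
probability `≥ e^{-cn}`. Since the macro-step OGP `macroNoStableSection` (`…MacroNoStableSection.lean`,
this seat) kills the much larger CHECKPOINTED events as well — uniformly in the block length `L` — the
transfer may be asked for correspondingly LESS:

**Theorem (`searchHardWindow_of_macroTransfer`).** `SearchHardWindow` follows from: for all large `k`,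
at `α_k = 5·2^k log k/k`, for all `η, ν > 0`, if some polynomial-time `f` solves `F_k(n, ⌊α_k n⌋)`
with probability `≥ ε` infinitely often, then for every `c > 0`, infinitely often in `n`, for SOME block
length `L ≥ 1` (which may depend on `n`) some map `g` is `ν`-valid at the checkpoints `q = i·L`,
`i ≤ ⌈m/L⌉·k`, of every sweep and `ηn`-stable between CONSECUTIVE checkpoints on `≥ e^{-cn} · #paths`
of the path tuples. Validity between checkpoints and stability under single-literal changes are no
longer required — a section may move by up to `ηn` per block of `L` resampled literals, e.g.
`L = Θ(n / polylog n)` literals per block. (Glue as in `CruxesImplyTarget`, with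
`positiveSatProbability_proof`.) This is the precise residual content of item 2460 given the tree.
No definitions; axioms standard.
-/

set_option linter.dupNamespace false -- `Summit.PneNP.PneNP.…`: summit = sub-problem (D-0017)

namespace Summit.PneNP.PneNP.Theorems

open Summit.PneNP.PneNP.Theses.OverlapGapAlgebra

/-- **`SearchHardWindow` from the macro-step transfer.** See the module docstring: the transfer is
asked only at the window density, only for large `k`, and only towards the CHECKPOINTED path event of
`macroNoStableSection` (some block length `L ≥ 1`, possibly depending on `n`). -/
theorem searchHardWindow_of_macroTransfer
    (hT : ∃ k₁ : ℕ, ∀ k : ℕ, k₁ ≤ k → ∀ η ν : ℝ, 0 < η → 0 < ν →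
      (∃ f : List Bool → List Bool, Literature.Computability.Complexity.IsPolyTime f ∧ ∃ ε : ℝ, 0 < ε ∧
        ∃ᶠ n : ℕ in Filter.atTop, ∀ m : ℕ, m = ⌊5 * 2 ^ k * Real.log k / k * n⌋₊ → ε ≤
          ((Finset.univ.filter fun Φ : Fin m → Fin k → Fin n × Bool => ∀ i, ∃ j,
            (f (Literature.Computability.Complexity.encodingCNF.encode (List.ofFn fun a =>
              List.ofFn fun b => (((Φ a b).1 : ℕ), (Φ a b).2)))).getD (Φ i j).1 false =
                (Φ i j).2).card : ℝ) / Fintype.card (Fin m → Fin k → Fin n × Bool)) →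
      ∀ c : ℝ, 0 < c → ∃ᶠ n : ℕ in Filter.atTop, ∀ m : ℕ, m = ⌊5 * 2 ^ k * Real.log k / k * n⌋₊ →
        ∃ L : ℕ, 1 ≤ L ∧ ∃ g : (Fin m → Fin k → Fin n × Bool) → (Fin n → Bool),
          Real.exp (-(c * n)) * Fintype.card (Fin (k + 1) → Fin m → Fin k → Fin n × Bool) ≤
          ((Finset.univ.filter fun Ψ : Fin (k + 1) → Fin m → Fin k → Fin n × Bool =>
            let P : Fin k → ℕ → Fin m → Fin k → Fin n × Bool := fun r q a b =>
              if (a : ℕ) * k + b < q then Ψ r.succ a b else Ψ r.castSucc a b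
            (∀ r : Fin k, ∀ i ≤ (m + L - 1) / L * k,
                ((Finset.univ.filter fun a : Fin m => ∀ j, g (P r (i * L)) (P r (i * L) a j).1 ≠
                  (P r (i * L) a j).2).card : ℝ) ≤ ν * m) ∧
              ∀ r : Fin k, ∀ i < (m + L - 1) / L * k,
                (hammingDist (g (P r (i * L))) (g (P r ((i + 1) * L))) : ℝ) ≤ η * n).card : ℝ)) :
    SearchHardWindow := by
  unfold SearchHardWindow
  obtain ⟨k₀, hk₀⟩ := macroNoStableSection
  obtain ⟨k₁, hk₁⟩ := hT
  obtain ⟨k₂, hk₂⟩ := positiveSatProbability_proof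
  obtain ⟨k, hk0, hk1, hk2, hk3⟩ : ∃ k : ℕ, k₀ ≤ k ∧ k₁ ≤ k ∧ k₂ ≤ k ∧ 3 ≤ k :=
    ⟨max (max k₀ k₁) (max k₂ 3),
      le_trans (le_max_left _ _) (le_max_left _ _), le_trans (le_max_right _ _) (le_max_left _ _),
      le_trans (le_max_left _ _) (le_max_right _ _), le_trans (le_max_right _ _) (le_max_right _ _)⟩
  obtain ⟨η, hη, ν, hν, c, hc, hev⟩ := hk₀ k hk0
  obtain ⟨ε, hε, hsat⟩ := hk₂ k hk2
  refine ⟨k, 5 * 2 ^ k * Real.log k / k, ⟨ε, hε, hsat⟩, ?_⟩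
  intro f hf ε' hε'
  by_contra hnot
  -- the macro transfer, fed with the frequent success of `f` and the rate `c/2`
  have key := hk₁ k hk1 η ν hη hν
    ⟨f, hf, ε', hε', (Filter.not_eventually.1 hnot).mono fun n hn m hm => by
      by_contra hlt
      exact hn fun m' hm' => by subst hm'; subst hm; exact (not_le.1 hlt).le⟩
    (c / 2) (half_pos hc)
  -- frequently (∃ L g, macro section) ∧ eventually (no macro section for any L, g) ⇒ False
  refine Filter.frequently_false (Filter.atTop : Filter ℕ)
    ((key.and_eventually (hev.and (Filter.eventually_ge_atTop 1))).mono ?_)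
  rintro n ⟨h₁, h₂, hn1⟩
  obtain ⟨L, hL, g, hg⟩ := h₁ _ rfl
  have hg' := h₂ _ rfl L hL g
  haveI : NeZero n := ⟨Nat.one_le_iff_ne_zero.1 hn1⟩
  exact overlapGap_exp_sandwich_false hc hn1 hg hg'

/-- **The summit from the macro-step transfer** (through the landed `Assembly` and `EvalRelationInP`). -/
theorem pneNP_of_macroTransfer
    (hT : ∃ k₁ : ℕ, ∀ k : ℕ, k₁ ≤ k → ∀ η ν : ℝ, 0 < η → 0 < ν →
      (∃ f : List Bool → List Bool, Literature.Computability.Complexity.IsPolyTime f ∧ ∃ ε : ℝ, 0 < ε ∧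
        ∃ᶠ n : ℕ in Filter.atTop, ∀ m : ℕ, m = ⌊5 * 2 ^ k * Real.log k / k * n⌋₊ → ε ≤
          ((Finset.univ.filter fun Φ : Fin m → Fin k → Fin n × Bool => ∀ i, ∃ j,
            (f (Literature.Computability.Complexity.encodingCNF.encode (List.ofFn fun a =>
              List.ofFn fun b => (((Φ a b).1 : ℕ), (Φ a b).2)))).getD (Φ i j).1 false =
                (Φ i j).2).card : ℝ) / Fintype.card (Fin m → Fin k → Fin n × Bool)) →
      ∀ c : ℝ, 0 < c → ∃ᶠ n : ℕ in Filter.atTop, ∀ m : ℕ, m = ⌊5 * 2 ^ k * Real.log k / k * n⌋₊ →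
        ∃ L : ℕ, 1 ≤ L ∧ ∃ g : (Fin m → Fin k → Fin n × Bool) → (Fin n → Bool),
          Real.exp (-(c * n)) * Fintype.card (Fin (k + 1) → Fin m → Fin k → Fin n × Bool) ≤
          ((Finset.univ.filter fun Ψ : Fin (k + 1) → Fin m → Fin k → Fin n × Bool =>
            let P : Fin k → ℕ → Fin m → Fin k → Fin n × Bool := fun r q a b =>
              if (a : ℕ) * k + b < q then Ψ r.succ a b else Ψ r.castSucc a b
            (∀ r : Fin k, ∀ i ≤ (m + L - 1) / L * k,
                ((Finset.univ.filter fun a : Fin m => ∀ j, g (P r (i * L)) (P r (i * L) a j).1 ≠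
                  (P r (i * L) a j).2).card : ℝ) ≤ ν * m) ∧
              ∀ r : Fin k, ∀ i < (m + L - 1) / L * k,
                (hammingDist (g (P r (i * L))) (g (P r ((i + 1) * L))) : ℝ) ≤ η * n).card : ℝ)) :
    _root_.PneNP :=
  closes ClassBridges_holds SearchFromDecision_holds overlapGap_evalRelationInP
    (searchHardWindow_of_macroTransfer hT)

end Summit.PneNP.PneNP.Theorems
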